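import Mathlib.GroupTheory.Perm.Fin
import Summits.ValiantsHypothesis.ValiantsHypothesis.Theorems.LacunarySymmetroidMatrixDescartesCensusTropicalKLawStatic

/-!
# Route `KPlusLogSqLaw`, crux `TropicalB` — PADDING / MONOTONICITY of the tropical census row in the format

HONEST FRAMING.  Helper file toward the registered stubs `stub_tropThin` / `stub_tropFat` of
`Cruxes/TropicalB/Lines/birth.lean` (crux `Summit.ValiantsHypothesis.ValiantsHypothesis.Theses.KPlusLogSqLaw.TropicalB`,
ledger item `stmt-ValiantsHypothesis-19771`, route `KPlusLogSqLaw`, DRAFT; cell `pub-symmetroid`, seat `val-sym-trop-p1`,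
2026-08-26).  It proves NO part of either stub.  It lands the format-monotonicity lemma that every glue step between
tropical rungs needs and that the tree did not have (onboarding note of the custody seat conjb-2 g3, §3.1(a)):

* `tropRootLawAt_of_le_classes` — `K ≤ K' → TropRootLawAt m K' B → TropRootLawAt m K B`
  (pad a design with `K' - K` classes that are absent everywhere: present terms, weights and signs are unchanged);
* `tropRootLawAt_of_succ`       — `TropRootLawAt (m+1) K B → TropRootLawAt m K B`
  (pad a design with one new index `0` carrying a single present entry `(0,0)` of one class, sign `+1`, valuation `0`;
  a Leibniz term `(σ, λ)` lifts to `(decomposeFin.symm (0, σ), Fin.cons l₀ λ)` with the same sign and the weight shifted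
  by `θ·d l₀`, and every present term of the padded design is such a lift);
* `tropRootLawAt_of_le`         — `m ≤ m' → K ≤ K' → TropRootLawAt m' K' B → TropRootLawAt m K B`.

So the tropical capacity `T(m, K)` (least `B` with `TropRootLawAt m K B`) is monotone in both `m` and `K`; e.g. a
square-tower rung `TropRootLawAt (K^2) K (2^(C·K))` would give the fat stub on all formats `m ≤ K^2` at once.

Vocabulary (tree): `TropicalCensus.TropRootLawAt` (`…CensusTropicalKLaw`), `IsDominant` / `termSign` / `tropWeight`
(`…MatrixDescartesFalseOfTropicalMonster`), `Equiv.Perm.decomposeFin` (Mathlib).  Nothing in this file asserts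
`TropicalB`, `KPlusLogSqLaw`, `MatrixDescartes` or anything about `VP ≠ VNP`.
-/

set_option linter.dupNamespace false
set_option autoImplicit false

namespace Summit.ValiantsHypothesis.ValiantsHypothesis.Theorems.KPlusLogSqLaw

open Summit.ValiantsHypothesis.ValiantsHypothesis.Theorems.MatrixDescartes.Negative
open Summit.ValiantsHypothesis.ValiantsHypothesis.Theorems.LacunarySymmetroidMatrixDescartes
open Summit.ValiantsHypothesis.ValiantsHypothesis.Theorems.LacunarySymmetroidMatrixDescartes.TropicalCensus
open scoped BigOperators
open Finset

/-! ## 1. Monotonicity in the number of classes -/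

/-- **Class padding.**  `K ≤ K' → TropRootLawAt m K' B → TropRootLawAt m K B`: a design with `K` classes is a design
with `K'` classes in which the extra classes are absent at every entry; the chain of dominant terms is carried along
the class embedding `Fin.castLE`, every present term of the padded design restricts back, and signs / weights agree.
[folklore] -/
theorem tropRootLawAt_of_le_classes {m K K' B : ℕ} (hK : K ≤ K') (h : TropRootLawAt m K' B) :
    TropRootLawAt m K B := by
  intro d v ε n θ p hε hθ hdom halt
  rcases Nat.eq_zero_or_pos K with hK0 | hKpos
  · subst hK0; exact tropRootLawAt_zero m B d v ε n θ p hε hθ hdom halt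
  -- the class embedding `ι` and a retraction `ρ`
  obtain ⟨ι, hιval⟩ : ∃ ι : Fin K → Fin K', ∀ l, ((ι l : Fin K') : ℕ) = l :=
    ⟨Fin.castLE hK, fun l => rfl⟩
  obtain ⟨ρ, hρval⟩ : ∃ ρ : Fin K' → Fin K, ∀ l' : Fin K', (l' : ℕ) < K → ((ρ l' : Fin K) : ℕ) = l' :=
    ⟨fun l' => if hl : (l' : ℕ) < K then ⟨l', hl⟩ else ⟨0, hKpos⟩, fun l' hl => by simp [hl]⟩
  have hιlt : ∀ l, ((ι l : Fin K') : ℕ) < K := fun l => by rw [hιval]; exact l.isLt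
  have hρι : ∀ l, ρ (ι l) = l := fun l => Fin.ext (by rw [hρval _ (hιlt l), hιval])
  have hιρ : ∀ l' : Fin K', (l' : ℕ) < K → ι (ρ l') = l' := fun l' hl => Fin.ext (by rw [hιval, hρval _ hl])
  -- the padded design
  obtain ⟨d', hd'⟩ : ∃ d' : Fin K' → ℕ, ∀ l', d' l' = if (l' : ℕ) < K then d (ρ l') else 0 := ⟨_, fun _ => rfl⟩
  obtain ⟨v', hv'⟩ : ∃ v' : Fin m → Fin m → Fin K' → ℤ,
      ∀ i j l', v' i j l' = if (l' : ℕ) < K then v i j (ρ l') else 0 := ⟨_, fun _ _ _ => rfl⟩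
  obtain ⟨ε', hε'⟩ : ∃ ε' : Fin m → Fin m → Fin K' → ℤ,
      ∀ i j l', ε' i j l' = if (l' : ℕ) < K then ε i j (ρ l') else 0 := ⟨_, fun _ _ _ => rfl⟩
  -- restriction of a `K'`-term all of whose classes are old: same sign, same weight
  have hsign : ∀ q : Equiv.Perm (Fin m) × (Fin m → Fin K'), (∀ i, ((q.2 i : Fin K') : ℕ) < K) →
      termSign ε' q = termSign ε (q.1, fun i => ρ (q.2 i)) := by
    intro q hq
    unfold termSign
    congr 1
    exact prod_congr rfl fun i _ => by rw [hε', if_pos (hq i)]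
  have hweight : ∀ q : Equiv.Perm (Fin m) × (Fin m → Fin K'), (∀ i, ((q.2 i : Fin K') : ℕ) < K) → ∀ t : ℤ,
      tropWeight d' v' t q = tropWeight d v t (q.1, fun i => ρ (q.2 i)) := by
    intro q hq t
    unfold tropWeight
    congr 1
    · congr 1
      exact sum_congr rfl fun i _ => by rw [hd', if_pos (hq i)]
    · exact sum_congr rfl fun i _ => by rw [hv', if_pos (hq i)]
  -- a present term of the padded design uses old classes only
  have hold : ∀ q : Equiv.Perm (Fin m) × (Fin m → Fin K'), termSign ε' q ≠ 0 →
      ∀ i, ((q.2 i : Fin K') : ℕ) < K := by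
    intro q hq i
    by_contra hi
    apply hq
    unfold termSign
    apply mul_eq_zero_of_right
    apply prod_eq_zero (mem_univ i)
    rw [hε', if_neg hi]
  -- the lifted chain
  obtain ⟨p', hp'⟩ : ∃ p' : Fin (n + 1) → Equiv.Perm (Fin m) × (Fin m → Fin K'),
      ∀ k, p' k = ((p k).1, fun i => ι ((p k).2 i)) := ⟨_, fun _ => rfl⟩
  have hp'old : ∀ k i, (((p' k).2 i : Fin K') : ℕ) < K := fun k i => by rw [hp']; exact hιlt _
  have hp'res : ∀ k, ((p' k).1, fun i => ρ ((p' k).2 i)) = p k := by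
    intro k
    rw [hp']
    exact Prod.ext rfl (funext fun i => hρι _)
  have hsign' : ∀ k, termSign ε' (p' k) = termSign ε (p k) := fun k => by
    rw [hsign _ (hp'old k), hp'res]
  have hε'1 : ∀ i j l', (ε' i j l').natAbs ≤ 1 := by
    intro i j l'
    rw [hε']
    split_ifs with hl
    · exact hε _ _ _
    · simp
  refine h d' v' ε' n θ p' hε'1 hθ (fun k => ⟨?_, fun q hq hqs => ?_⟩)
    (fun k => by rw [hsign', hsign']; exact halt k)
  · rw [hsign']; exact (hdom k).1
  · have hq' := hold q hqs
    rw [hweight q hq', hweight (p' k) (hp'old k), hp'res]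
    refine (hdom k).2 _ (fun hh => hq ?_) (by rw [← hsign q hq']; exact hqs)
    -- from `(q.1, ρ ∘ q.2) = p k` deduce `q = p' k`
    have h1 : q.1 = (p k).1 := congrArg Prod.fst hh
    have h2 : ∀ i, ρ (q.2 i) = (p k).2 i := fun i => congrFun (congrArg Prod.snd hh) i
    rw [hp']
    refine Prod.ext h1 (funext fun i => ?_)
    show q.2 i = ι ((p k).2 i)
    rw [← h2 i, hιρ _ (hq' i)]

/-! ## 2. Monotonicity in the size -/

/-- **Size padding by one.**  `TropRootLawAt (m+1) K B → TropRootLawAt m K B`: border a design of size `m` by a new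
index `0` whose only present entry is `(0, 0)`, of one class `l₀`, sign `+1`, valuation `0`.  The Leibniz term
`(σ, λ)` lifts to `(decomposeFin.symm (0, σ), Fin.cons l₀ λ)`, with the same sign (`decomposeFin.symm_sign`) and weight
shifted by `θ·d l₀`; every present term of the bordered design is such a lift (its permutation fixes `0`), so unique
optima, their order and the sign alternation are preserved. [folklore] -/
theorem tropRootLawAt_of_succ {m K B : ℕ} (h : TropRootLawAt (m + 1) K B) : TropRootLawAt m K B := by
  intro d v ε n θ p hε hθ hdom halt
  rcases Nat.eq_zero_or_pos K with hK0 | hKpos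
  · subst hK0; exact tropRootLawAt_zero m B d v ε n θ p hε hθ hdom halt
  set l₀ : Fin K := ⟨0, hKpos⟩ with hl₀
  -- the bordered design
  obtain ⟨εb, hεb⟩ : ∃ εb : Fin (m + 1) → Fin (m + 1) → Fin K → ℤ, ∀ a b l, εb a b l =
      if ha : a = 0 then (if b = 0 then (if l = l₀ then 1 else 0) else 0)
      else (if hb : b = 0 then 0 else ε (a.pred ha) (b.pred hb) l) := ⟨_, fun _ _ _ => rfl⟩
  obtain ⟨vb, hvb⟩ : ∃ vb : Fin (m + 1) → Fin (m + 1) → Fin K → ℤ, ∀ a b l, vb a b l =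
      if ha : a = 0 then 0 else (if hb : b = 0 then 0 else v (a.pred ha) (b.pred hb) l) := ⟨_, fun _ _ _ => rfl⟩
  have hεsucc : ∀ x y l, εb x.succ y.succ l = ε x y l := by
    intro x y l
    rw [hεb, dif_neg (Fin.succ_ne_zero x), dif_neg (Fin.succ_ne_zero y)]
    simp only [Fin.pred_succ]
  have hvsucc : ∀ x y l, vb x.succ y.succ l = v x y l := by
    intro x y l
    rw [hvb, dif_neg (Fin.succ_ne_zero x), dif_neg (Fin.succ_ne_zero y)]
    simp only [Fin.pred_succ]
  have hε00 : εb 0 0 l₀ = 1 := by rw [hεb]; simp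
  have hv0 : ∀ b l, vb 0 b l = 0 := by intro b l; rw [hvb]; simp
  have hεb1 : ∀ a b l, (εb a b l).natAbs ≤ 1 := by
    intro a b l
    rw [hεb]
    split_ifs <;> first | exact hε _ _ _ | simp
  -- the extension of a permutation: `decomposeFin.symm (0, σ)` fixes `0` and acts by `σ` on successors
  have hext0 : ∀ σ : Equiv.Perm (Fin m), Equiv.Perm.decomposeFin.symm (0, σ) 0 = 0 :=
    fun σ => Equiv.Perm.decomposeFin_symm_apply_zero 0 σ
  have hextsucc : ∀ (σ : Equiv.Perm (Fin m)) (i : Fin m),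
      Equiv.Perm.decomposeFin.symm (0, σ) i.succ = (σ i).succ := by
    intro σ i
    rw [Equiv.Perm.decomposeFin_symm_apply_succ, Equiv.swap_self, Equiv.refl_apply]
  -- sign and weight of a lifted term
  have hsignL : ∀ (σ : Equiv.Perm (Fin m)) (μ : Fin m → Fin K),
      termSign εb (Equiv.Perm.decomposeFin.symm (0, σ), (Fin.cons l₀ μ : Fin (m + 1) → Fin K)) =
        termSign ε (σ, μ) := by
    intro σ μ
    unfold termSign
    simp only
    rw [Equiv.Perm.decomposeFin.symm_sign, if_pos rfl, one_mul, Fin.prod_univ_succ, hext0, Fin.cons_zero, hε00,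
      one_mul]
    congr 1
    exact prod_congr rfl fun i _ => by rw [hextsucc, Fin.cons_succ, hεsucc]
  have hweightL : ∀ (σ : Equiv.Perm (Fin m)) (μ : Fin m → Fin K) (t : ℤ),
      tropWeight d vb t (Equiv.Perm.decomposeFin.symm (0, σ), (Fin.cons l₀ μ : Fin (m + 1) → Fin K)) =
        tropWeight d v t (σ, μ) + t * d l₀ := by
    intro σ μ t
    unfold tropWeight
    simp only
    rw [Fin.sum_univ_succ, Fin.sum_univ_succ, Fin.cons_zero, hext0, hv0]
    have e1 : ∑ i : Fin m, (d ((Fin.cons l₀ μ : Fin (m + 1) → Fin K) i.succ) : ℤ) = ∑ i, (d (μ i) : ℤ) :=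
      sum_congr rfl fun i _ => by rw [Fin.cons_succ]
    have e2 : ∑ i : Fin m, vb (Equiv.Perm.decomposeFin.symm (0, σ) i.succ) i.succ
        ((Fin.cons l₀ μ : Fin (m + 1) → Fin K) i.succ) = ∑ i, v (σ i) i (μ i) :=
      sum_congr rfl fun i _ => by rw [hextsucc, Fin.cons_succ, hvsucc]
    rw [e1, e2]
    ring
  -- every present term of the bordered design is a lift
  have hpresent : ∀ q : Equiv.Perm (Fin (m + 1)) × (Fin (m + 1) → Fin K), termSign εb q ≠ 0 →
      ∃ (σ : Equiv.Perm (Fin m)) (μ : Fin m → Fin K),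
        q = (Equiv.Perm.decomposeFin.symm (0, σ), (Fin.cons l₀ μ : Fin (m + 1) → Fin K)) := by
    intro q hq
    have hfac : ∀ i, εb (q.1 i) i (q.2 i) ≠ 0 := present_of_termSign_ne_zero εb q hq
    have hq0 : q.1 0 = 0 := by
      by_contra hne
      apply hfac 0
      rw [hεb, dif_neg hne, dif_pos rfl]
    have hμ0 : q.2 0 = l₀ := by
      have h0 := hfac 0
      rw [hq0, hεb, dif_pos rfl, if_pos rfl] at h0
      by_contra hne
      exact h0 (if_neg hne)
    obtain ⟨P, hP⟩ : ∃ P : Fin (m + 1) × Equiv.Perm (Fin m), q.1 = Equiv.Perm.decomposeFin.symm P :=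
      ⟨Equiv.Perm.decomposeFin q.1, (Equiv.symm_apply_apply _ _).symm⟩
    obtain ⟨x, σ⟩ := P
    have hx : x = 0 := by
      have h0 := hq0
      rw [hP, Equiv.Perm.decomposeFin_symm_apply_zero] at h0
      exact h0
    subst hx
    refine ⟨σ, Fin.tail q.2, Prod.ext hP ?_⟩
    show q.2 = Fin.cons l₀ (Fin.tail q.2)
    rw [← hμ0]
    exact (Fin.cons_self_tail q.2).symm
  -- the lifted chain
  obtain ⟨pb, hpb⟩ : ∃ pb : Fin (n + 1) → Equiv.Perm (Fin (m + 1)) × (Fin (m + 1) → Fin K),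
      ∀ k, pb k = (Equiv.Perm.decomposeFin.symm (0, (p k).1), (Fin.cons l₀ (p k).2 : Fin (m + 1) → Fin K)) :=
    ⟨_, fun _ => rfl⟩
  have hsign' : ∀ k, termSign εb (pb k) = termSign ε (p k) := fun k => by rw [hpb, hsignL]
  refine h d vb εb n θ pb hεb1 hθ (fun k => ⟨?_, fun q hq hqs => ?_⟩)
    (fun k => by rw [hsign', hsign']; exact halt k)
  · rw [hsign']; exact (hdom k).1
  · obtain ⟨σ, μ, rfl⟩ := hpresent q hqs
    have hne : (σ, μ) ≠ p k := by
      intro hh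
      apply hq
      rw [hpb, ← hh]
    have hqs' : termSign ε (σ, μ) ≠ 0 := by rwa [hsignL] at hqs
    have hlt := (hdom k).2 (σ, μ) hne hqs'
    rw [hpb, hweightL, hweightL]
    linarith

/-- **Format monotonicity of the tropical census row.**  `m ≤ m' → K ≤ K' → TropRootLawAt m' K' B → TropRootLawAt m K B`:
the tropical capacity `T(m, K)` is monotone in the size and in the number of classes. [folklore] -/
theorem tropRootLawAt_of_le {m m' K K' B : ℕ} (hm : m ≤ m') (hK : K ≤ K') (h : TropRootLawAt m' K' B) :
    TropRootLawAt m K B := by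
  have hK' : TropRootLawAt m' K B := tropRootLawAt_of_le_classes hK h
  obtain ⟨t, rfl⟩ := Nat.exists_eq_add_of_le hm
  clear hm h
  induction t with
  | zero => exact hK'
  | succ t ih => exact ih (tropRootLawAt_of_succ hK')

end Summit.ValiantsHypothesis.ValiantsHypothesis.Theorems.KPlusLogSqLaw
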